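import Literature.NumberTheory.LFunctions.GaussianHeckeMollifier
import Literature.NumberTheory.LFunctions.GaussianHeckeHybridMeanValue
import Literature.NumberTheory.LFunctions.GaussianHeckeDivisorMoments
import HarnessLib

/-!
# The mean square of the mollifier over the family: `∑_{m ≤ K} |M_X(1/2 + iτ; λ^m)|² ≪ (X + K) log³ X`

Topic `Literature/NumberTheory/LFunctions`.  Everything in this file is PROVED; no definitions, no named
facts.  For the mollifier `M_X(s; λ^m) = ∑_{d ∈ ℤ[i]*, N(d) ≤ X} μ(d) λ^m(d) N(d)^{-s} = L(moebCoeff m X, s)`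
(`GaussianHeckeMollifier.lean`) we prove the class-II input of the zero-detection method
(`GaussianHecke.exists_sum_norm_sq_mollifier_le`): there is an absolute `C` with

  `∑_{m=1}^{K} |M_X(1/2 + iτ; λ^m)|² ≤ C (X + K)(1 + log X)³`   for `X ≥ 1`, `K ≥ 1`, every real `τ`.

The mean value theorem for Hecke polynomials (hypothesis `hMVT`, the named fact
`JarviniemiTeravainen2024_heckeMVT`, discharged in the tree) controls a Hecke polynomial by the RAY-SUM
majorant `∑ |a_d|² g(d) √(N/N(d))`, which for `a_d = μ(d) N(d)^{-1/2}` on the whole disc `N(d) ≤ X` would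
lose `√X`; so `M_X` is cut into dyadic blocks `2^j ≤ N(d) < 2^{j+1}` (`J₀ ≤ 3(1 + log X)` of them),
`|∑_j M_j|² ≤ J₀ ∑_j |M_j|²`, and on a block the weight is `≤ √2 g(d)/N(d)`, whose sum is `≪ 1 + log X`
by `GaussianHecke.sum_content_le`.

## References

* H. L. Montgomery, *Topics in Multiplicative Number Theory*, LNM 227 (1971), Ch. 12. [Montgomery1971]
-/

noncomputable section

open Complex Finset Real UniqueFactorizationMonoid
open scoped ComplexConjugate

namespace Literature.NumberTheory.LFunctions

namespace GaussianHecke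

open GaussianInt

open scoped Classical

/-- Cauchy–Schwarz for a finite sum of complex numbers: `‖∑_{j ∈ s} z_j‖² ≤ #s · ∑ ‖z_j‖²`. [folklore] -/
theorem norm_sum_sq_le_card_mul {ι : Type*} (s : Finset ι) (z : ι → ℂ) :
    ‖∑ j ∈ s, z j‖ ^ 2 ≤ s.card * ∑ j ∈ s, ‖z j‖ ^ 2 :=
  calc ‖∑ j ∈ s, z j‖ ^ 2 ≤ (∑ j ∈ s, ‖z j‖) ^ 2 :=
        pow_le_pow_left₀ (norm_nonneg _) (norm_sum_le _ _) 2
    _ ≤ s.card * ∑ j ∈ s, ‖z j‖ ^ 2 := sq_sum_le_card_mul_sum_sq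

/-- `∑_{d ∈ ℤ[i]*, 2^j ≤ N(d) < 2^{j+1}, N(d) ≤ X} g(d)/N(d) ≤ 36 (1 + log 2^{j+1})` (content sum on a dyadic block).
[folklore] -/
theorem sum_content_div_norm_block_le (X : ℝ) (j : ℕ) :
    ∑ d ∈ (normLEStar X).filter (fun d ↦ Nat.log 2 d.norm.toNat = j), (GaussianInt.content d : ℝ) / (d.norm : ℝ) ≤
      36 * (1 + Real.log ((2 : ℝ) ^ (j + 1))) := by
  have hblock : ∀ d ∈ (normLEStar X).filter (fun d ↦ Nat.log 2 d.norm.toNat = j),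
      ((2 : ℝ) ^ j) ≤ (d.norm : ℝ) ∧ (d.norm : ℝ) ≤ (2 : ℝ) ^ (j + 1) := by
    intro d hd
    rw [mem_filter, mem_normLEStar] at hd
    have hpos := norm_pos_of_mem_firstQuadrant hd.1.2
    have h0 : 0 ≤ d.norm := hpos.le
    have hcast : (d.norm : ℝ) = ((d.norm.toNat : ℕ) : ℝ) := by exact_mod_cast (Int.toNat_of_nonneg h0).symm
    have hne : d.norm.toNat ≠ 0 := by omega
    have hge : 2 ^ j ≤ d.norm.toNat := by
      have := Nat.pow_log_le_self 2 hne; rw [hd.2] at this; exact this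
    have hlt : d.norm.toNat < 2 ^ (j + 1) := by
      have := Nat.lt_pow_succ_log_self (b := 2) (by norm_num) d.norm.toNat; rw [hd.2] at this; exact this
    rw [hcast]
    exact ⟨by exact_mod_cast hge, by exact_mod_cast hlt.le⟩
  have hsub : (normLEStar X).filter (fun d ↦ Nat.log 2 d.norm.toNat = j) ⊆ normLEStar ((2 : ℝ) ^ (j + 1)) := by
    intro d hd
    have h := (hblock d hd).2
    rw [mem_filter, mem_normLEStar] at hd
    rw [mem_normLEStar]
    exact ⟨h, hd.1.2⟩
  have hterm : ∀ d ∈ (normLEStar X).filter (fun d ↦ Nat.log 2 d.norm.toNat = j),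
      (GaussianInt.content d : ℝ) / (d.norm : ℝ) ≤ (GaussianInt.content d : ℝ) * ((2 : ℝ) ^ j)⁻¹ := by
    intro d hd
    have h := (hblock d hd).1
    rw [div_eq_mul_inv]
    exact mul_le_mul_of_nonneg_left (inv_anti₀ (by positivity) h) (Nat.cast_nonneg _)
  have h2j : (1 : ℝ) ≤ (2 : ℝ) ^ (j + 1) := one_le_pow₀ (by norm_num)
  calc ∑ d ∈ (normLEStar X).filter (fun d ↦ Nat.log 2 d.norm.toNat = j), (GaussianInt.content d : ℝ) / (d.norm : ℝ)
      ≤ ∑ d ∈ (normLEStar X).filter (fun d ↦ Nat.log 2 d.norm.toNat = j),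
          (GaussianInt.content d : ℝ) * ((2 : ℝ) ^ j)⁻¹ := sum_le_sum hterm
    _ = (∑ d ∈ (normLEStar X).filter (fun d ↦ Nat.log 2 d.norm.toNat = j), (GaussianInt.content d : ℝ)) *
          ((2 : ℝ) ^ j)⁻¹ := by rw [sum_mul]
    _ ≤ (∑ d ∈ normLEStar ((2 : ℝ) ^ (j + 1)), (GaussianInt.content d : ℝ)) * ((2 : ℝ) ^ j)⁻¹ := by
        refine mul_le_mul_of_nonneg_right (sum_le_sum_of_subset_of_nonneg hsub fun _ _ _ ↦ Nat.cast_nonneg _)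
          (by positivity)
    _ ≤ (9 * (2 : ℝ) ^ (j + 1) * (1 + Real.log ((2 : ℝ) ^ (j + 1)))) * ((2 : ℝ) ^ j)⁻¹ :=
        mul_le_mul_of_nonneg_right (sum_content_le h2j) (by positivity)
    _ = 36 * (1 + Real.log ((2 : ℝ) ^ (j + 1))) / 2 := by rw [pow_succ]; field_simp; ring
    _ ≤ 36 * (1 + Real.log ((2 : ℝ) ^ (j + 1))) := by
        have : 0 ≤ 1 + Real.log ((2 : ℝ) ^ (j + 1)) := by linarith [Real.log_nonneg h2j]
        linarith [mul_nonneg (by norm_num : (0:ℝ) ≤ 36) this]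

set_option maxHeartbeats 1600000 in
/-- **Mean square of the mollifier over the family** (see the module docstring): there is an absolute
`C ≥ 0` with `∑_{m=1}^{K} |M_X(1/2 + iτ; λ^m)|² ≤ C (X + K)(1 + log X)³` for `X, K ≥ 1` and all real `τ`.
Relies on: hypothesis `hMVT` (discharged in the tree: `JarviniemiTeravainen2024_heckeMVT_holds`).
[cite: Montgomery1971, Ch. 12] -/
theorem exists_sum_norm_sq_mollifier_le (hMVT : JarviniemiTeravainen2024_heckeMVT) :
    ∃ C : ℝ, 0 ≤ C ∧ ∀ (X : ℝ) (K : ℕ) (τ : ℝ), 1 ≤ X → 1 ≤ K →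
      ∑ m ∈ Icc 1 K, ‖LSeries (moebCoeff m X) (1 / 2 + τ * I)‖ ^ 2 ≤ C * (X + K) * (1 + Real.log X) ^ 3 := by
  obtain ⟨C₀, hC₀, hMV⟩ := exists_sum_norm_sq_heckeSum_twist_le hMVT
  refine ⟨2000 * C₀, by positivity, fun X K τ hX hK ↦ ?_⟩
  have hX0 : 0 < X := by linarith
  have hK1 : (1 : ℝ) ≤ K := by exact_mod_cast hK
  set L : ℝ := 1 + Real.log X with hL
  have hL1 : 1 ≤ L := by rw [hL]; linarith [Real.log_nonneg hX]
  -- dyadic blocks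
  set J₀ : ℕ := Nat.log 2 ⌊X⌋₊ + 1 with hJ₀
  have hJ₀L : (J₀ : ℝ) ≤ 3 * L := by
    have hlog : ((Nat.log 2 ⌊X⌋₊ : ℕ) : ℝ) ≤ Real.log X / Real.log 2 := by
      rw [le_div_iff₀ (Real.log_pos one_lt_two), ← Real.log_pow]
      refine Real.log_le_log (by positivity) ?_
      have h1 : (2 : ℕ) ^ Nat.log 2 ⌊X⌋₊ ≤ ⌊X⌋₊ :=
        Nat.pow_log_le_self 2 (Nat.pos_iff_ne_zero.1 (Nat.floor_pos.2 hX))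
      calc ((2 : ℝ)) ^ Nat.log 2 ⌊X⌋₊ = ((2 ^ Nat.log 2 ⌊X⌋₊ : ℕ) : ℝ) := by push_cast; ring
        _ ≤ (⌊X⌋₊ : ℝ) := by exact_mod_cast h1
        _ ≤ X := Nat.floor_le hX0.le
    have hlog2 : Real.log 2 > 0.6931471803 := Real.log_two_gt_d9
    have hly : 0 ≤ Real.log X := Real.log_nonneg hX
    rw [hJ₀]; push_cast
    have : Real.log X / Real.log 2 ≤ 2 * Real.log X := by rw [div_le_iff₀ (by linarith)]; nlinarith
    rw [hL]; linarith
  -- block coefficients `a_j(d) = [d in block j] μ(d) N(d)^{-1/2}`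
  set a : ℕ → _root_.GaussianInt → ℂ := fun j d ↦
    if d ∈ normLEStar X ∧ Nat.log 2 d.norm.toNat = j then (moebius d : ℂ) * ((d.norm.natAbs : ℕ) : ℂ) ^ (-(1 / 2 : ℂ)) else 0
    with ha
  -- the blocks `M_j(m) = ∑_d a_j(d) N(d)^{-iτ} λ^m(d)`, as Hecke polynomials of level `2^{j+1}`
  have hblockmem : ∀ j (d : _root_.GaussianInt), d ∈ normLEStar X → Nat.log 2 d.norm.toNat = j →
      d ∈ normLEStar ((2 : ℝ) ^ (j + 1)) := by
    intro j d hd hj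
    rw [mem_normLEStar] at hd ⊢
    refine ⟨?_, hd.2⟩
    have hpos := norm_pos_of_mem_firstQuadrant hd.2
    have h0 : 0 ≤ d.norm := hpos.le
    have hcast : (d.norm : ℝ) = ((d.norm.toNat : ℕ) : ℝ) := by exact_mod_cast (Int.toNat_of_nonneg h0).symm
    have hlt : d.norm.toNat < 2 ^ (j + 1) := by
      have := Nat.lt_pow_succ_log_self (b := 2) (by norm_num) d.norm.toNat; rw [hj] at this; exact this
    rw [hcast]; exact_mod_cast hlt.le
  -- `M_X(1/2+iτ; m) = ∑_{j < J₀} heckeSum (2^{j+1}) (a_j · twist) m`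
  have hdecomp : ∀ m : ℕ, LSeries (moebCoeff m X) (1 / 2 + τ * I) =
      ∑ j ∈ range J₀, heckeSum ((2 : ℝ) ^ (j + 1))
        (fun d ↦ a j d * ((d.norm.natAbs : ℕ) : ℂ) ^ (-((τ : ℂ) * I))) m := by
    intro m
    rw [LSeries_moebCoeff_eq_sum]
    -- regroup the `d`-sum by the block index
    have hmaps : ∀ d ∈ normLEStar X, Nat.log 2 d.norm.toNat ∈ range J₀ := by
      intro d hd
      rw [mem_normLEStar] at hd
      rw [mem_range, hJ₀, Nat.lt_succ_iff]
      refine Nat.log_mono_right (Nat.le_floor ?_)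
      have h0 : 0 ≤ d.norm := GaussianInt.norm_nonneg d
      have : ((d.norm.toNat : ℕ) : ℝ) = (d.norm : ℝ) := by exact_mod_cast Int.toNat_of_nonneg h0
      rw [this]; exact hd.1
    rw [← sum_fiberwise_of_maps_to hmaps]
    refine sum_congr rfl fun j _ ↦ ?_
    -- the `j`-th fibre sum equals the Hecke polynomial of level `2^{j+1}` with coefficients `a_j`
    rw [heckeSum]
    symm
    rw [← sum_subset (s₁ := (normLEStar X).filter (fun d ↦ Nat.log 2 d.norm.toNat = j))]
    · refine sum_congr rfl fun d hd ↦ ?_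
      rw [mem_filter] at hd
      have hd0 : d.norm.natAbs ≠ 0 := natAbs_norm_ne_zero (mem_normLEStar.1 hd.1).2
      have hdC : ((d.norm.natAbs : ℕ) : ℂ) ≠ 0 := Nat.cast_ne_zero.2 hd0
      simp only [ha, hd, and_self, if_true, angularCharZ_natCast]
      rw [show -((1 : ℂ) / 2 + τ * I) = -(1 / 2 : ℂ) + -((τ : ℂ) * I) by ring, cpow_add _ _ hdC]
      ring
    · intro d hd
      rw [mem_filter] at hd
      exact hblockmem j d hd.1 hd.2
    · intro d _ hd
      have : ¬ (d ∈ normLEStar X ∧ Nat.log 2 d.norm.toNat = j) := by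
        intro h; exact hd (mem_filter.2 h)
      simp only [ha, this, if_false, zero_mul]
  -- the weight of `a_j` is `≤ 72 √2 L ≤ 102 L`
  have hW : ∀ j ∈ range J₀, ∑ d ∈ normLEStar ((2 : ℝ) ^ (j + 1)),
      ‖a j d‖ ^ 2 * (GaussianInt.content d * Real.sqrt ((2 : ℝ) ^ (j + 1) / d.norm)) ≤ 102 * L := by
    intro j hj
    have hjX : (2 : ℝ) ^ j ≤ X := by
      rw [mem_range, hJ₀, Nat.lt_succ_iff] at hj
      have h1 : (2 : ℕ) ^ j ≤ ⌊X⌋₊ := (Nat.pow_le_pow_right (by norm_num) hj).trans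
        (Nat.pow_log_le_self 2 (Nat.pos_iff_ne_zero.1 (Nat.floor_pos.2 hX)))
      calc ((2 : ℝ)) ^ j = ((2 ^ j : ℕ) : ℝ) := by push_cast; ring
        _ ≤ (⌊X⌋₊ : ℝ) := by exact_mod_cast h1
        _ ≤ X := Nat.floor_le hX0.le
    -- only block terms survive, each `≤ √2 g(d)/N(d)`
    have hterm : ∀ d ∈ normLEStar ((2 : ℝ) ^ (j + 1)),
        ‖a j d‖ ^ 2 * (GaussianInt.content d * Real.sqrt ((2 : ℝ) ^ (j + 1) / d.norm)) ≤
          if d ∈ normLEStar X ∧ Nat.log 2 d.norm.toNat = j then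
            Real.sqrt 2 * ((GaussianInt.content d : ℝ) / (d.norm : ℝ)) else 0 := by
      intro d hd2
      by_cases h : d ∈ normLEStar X ∧ Nat.log 2 d.norm.toNat = j
      · rw [if_pos h]
        simp only [ha, h, and_self, if_true]
        have hdq := (mem_normLEStar.1 h.1).2
        have hpos : 0 < d.norm.natAbs := Nat.pos_of_ne_zero (natAbs_norm_ne_zero hdq)
        have hNd : (0 : ℝ) < (d.norm : ℝ) := by exact_mod_cast norm_pos_of_mem_firstQuadrant hdq
        rw [norm_mul, Complex.norm_intCast, Complex.norm_natCast_cpow_of_pos hpos, mul_pow]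
        simp only [neg_re, one_div]
        have hnn : ((d.norm.natAbs : ℕ) : ℝ) = (d.norm : ℝ) := natAbs_norm_real d
        -- `(N^{-1/2})² = N⁻¹`
        have e1 : (((d.norm.natAbs : ℕ) : ℝ) ^ (-(2 : ℂ)⁻¹.re)) ^ 2 = ((d.norm : ℝ))⁻¹ := by
          rw [← hnn, ← Real.rpow_natCast, ← Real.rpow_mul (by positivity)]
          norm_num
          rw [Real.rpow_neg_one]
        rw [e1]
        have hμ : |(moebius d : ℝ)| ^ 2 ≤ 1 := by
          have := abs_moebius_le_one d
          have h' : |(moebius d : ℝ)| ≤ 1 := by exact_mod_cast this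
          calc |(moebius d : ℝ)| ^ 2 ≤ 1 ^ 2 := pow_le_pow_left₀ (abs_nonneg _) h' 2
            _ = 1 := one_pow 2
        -- `√(2^{j+1}/N(d)) ≤ √2` on the block
        have hblk : ((2 : ℝ) ^ j) ≤ (d.norm : ℝ) := by
          have h0 : 0 ≤ d.norm := (norm_pos_of_mem_firstQuadrant hdq).le
          have hcast : (d.norm : ℝ) = ((d.norm.toNat : ℕ) : ℝ) := by exact_mod_cast (Int.toNat_of_nonneg h0).symm
          have hne : d.norm.toNat ≠ 0 := by have := norm_pos_of_mem_firstQuadrant hdq; omega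
          have hge : 2 ^ j ≤ d.norm.toNat := by
            have := Nat.pow_log_le_self 2 hne; rw [h.2] at this; exact this
          rw [hcast]; exact_mod_cast hge
        have hsqrt : Real.sqrt ((2 : ℝ) ^ (j + 1) / d.norm) ≤ Real.sqrt 2 := by
          refine Real.sqrt_le_sqrt ?_
          rw [div_le_iff₀ hNd, pow_succ]
          nlinarith
        have hg0 : (0 : ℝ) ≤ GaussianInt.content d := Nat.cast_nonneg _
        calc |(moebius d : ℝ)| ^ 2 * ((d.norm : ℝ))⁻¹ * (GaussianInt.content d * Real.sqrt ((2 : ℝ) ^ (j + 1) / d.norm))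
            ≤ 1 * ((d.norm : ℝ))⁻¹ * (GaussianInt.content d * Real.sqrt 2) := by
              gcongr
          _ = Real.sqrt 2 * ((GaussianInt.content d : ℝ) / (d.norm : ℝ)) := by ring
      · rw [if_neg h]
        simp only [ha, h, if_false, norm_zero]
        simp
    calc ∑ d ∈ normLEStar ((2 : ℝ) ^ (j + 1)),
          ‖a j d‖ ^ 2 * (GaussianInt.content d * Real.sqrt ((2 : ℝ) ^ (j + 1) / d.norm))
        ≤ ∑ d ∈ normLEStar ((2 : ℝ) ^ (j + 1)),
            (if d ∈ normLEStar X ∧ Nat.log 2 d.norm.toNat = j then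
              Real.sqrt 2 * ((GaussianInt.content d : ℝ) / (d.norm : ℝ)) else 0) := sum_le_sum hterm
      _ ≤ ∑ d ∈ (normLEStar X).filter (fun d ↦ Nat.log 2 d.norm.toNat = j),
            Real.sqrt 2 * ((GaussianInt.content d : ℝ) / (d.norm : ℝ)) := by
          rw [← sum_filter]
          refine sum_le_sum_of_subset_of_nonneg ?_ fun d _ _ ↦ ?_
          · intro d hd
            rw [mem_filter] at hd ⊢
            exact hd.2
          · have : (0 : ℝ) ≤ (d.norm : ℝ) := by exact_mod_cast GaussianInt.norm_nonneg d
            positivity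
      _ = Real.sqrt 2 * ∑ d ∈ (normLEStar X).filter (fun d ↦ Nat.log 2 d.norm.toNat = j),
            (GaussianInt.content d : ℝ) / (d.norm : ℝ) := by rw [mul_sum]
      _ ≤ Real.sqrt 2 * (36 * (1 + Real.log ((2 : ℝ) ^ (j + 1)))) :=
          mul_le_mul_of_nonneg_left (sum_content_div_norm_block_le X j) (Real.sqrt_nonneg 2)
      _ ≤ 102 * L := by
          have hs2 : Real.sqrt 2 ≤ 1.415 := by
            rw [Real.sqrt_le_left (by norm_num)]; norm_num
          have hlog : Real.log ((2 : ℝ) ^ (j + 1)) ≤ 1 + Real.log X := by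
            rw [pow_succ, Real.log_mul (by positivity) (by norm_num)]
            have h2 : Real.log 2 ≤ 1 := by
              have := Real.log_two_lt_d9; linarith
            have : Real.log ((2 : ℝ) ^ j) ≤ Real.log X := Real.log_le_log (by positivity) hjX
            linarith
          have hl0 : 0 ≤ 1 + Real.log ((2 : ℝ) ^ (j + 1)) := by
            linarith [Real.log_nonneg (one_le_pow₀ (by norm_num : (1:ℝ) ≤ 2) : (1 : ℝ) ≤ 2 ^ (j + 1))]
          rw [hL]
          nlinarith [Real.sqrt_nonneg 2]
  -- the MVT on each block, summed over `m ≤ K` (embedded in `|m| ≤ K`)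
  have hblockMV : ∀ j ∈ range J₀, ∑ m ∈ Icc 1 K, ‖heckeSum ((2 : ℝ) ^ (j + 1))
      (fun d ↦ a j d * ((d.norm.natAbs : ℕ) : ℂ) ^ (-((τ : ℂ) * I))) m‖ ^ 2 ≤ C₀ * (2 * X + K) * (102 * L) := by
    intro j hj
    have h2j : (1 : ℝ) ≤ (2 : ℝ) ^ (j + 1) := one_le_pow₀ (by norm_num)
    have hjX : (2 : ℝ) ^ (j + 1) ≤ 2 * X := by
      rw [mem_range, hJ₀, Nat.lt_succ_iff] at hj
      have h1 : (2 : ℕ) ^ j ≤ ⌊X⌋₊ := (Nat.pow_le_pow_right (by norm_num) hj).trans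
        (Nat.pow_log_le_self 2 (Nat.pos_iff_ne_zero.1 (Nat.floor_pos.2 hX)))
      have : ((2 : ℝ)) ^ j ≤ X := by
        calc ((2 : ℝ)) ^ j = ((2 ^ j : ℕ) : ℝ) := by push_cast; ring
          _ ≤ (⌊X⌋₊ : ℝ) := by exact_mod_cast h1
          _ ≤ X := Nat.floor_le hX0.le
      rw [pow_succ]; linarith
    have h1 := hMV ((2 : ℝ) ^ (j + 1)) K (a j) τ h2j hK
    -- embed `Icc 1 K` into `Icc (-K) K`
    have hsub : ∑ m ∈ Icc 1 K, ‖heckeSum ((2 : ℝ) ^ (j + 1))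
        (fun d ↦ a j d * ((d.norm.natAbs : ℕ) : ℂ) ^ (-((τ : ℂ) * I))) m‖ ^ 2 ≤
        ∑ m ∈ Icc (-(K : ℤ)) K, ‖heckeSum ((2 : ℝ) ^ (j + 1))
          (fun d ↦ a j d * ((d.norm.natAbs : ℕ) : ℂ) ^ (-((τ : ℂ) * I))) m‖ ^ 2 := by
      rw [← sum_image (f := fun m : ℤ ↦ ‖heckeSum ((2 : ℝ) ^ (j + 1))
          (fun d ↦ a j d * ((d.norm.natAbs : ℕ) : ℂ) ^ (-((τ : ℂ) * I))) m‖ ^ 2)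
          (s := Icc 1 K) (g := fun m : ℕ ↦ (m : ℤ)) (fun m _ m' _ h ↦ by
            have h' : (m : ℤ) = m' := h; exact_mod_cast h')]
      refine sum_le_sum_of_subset_of_nonneg ?_ fun _ _ _ ↦ by positivity
      intro m hm
      rw [mem_image] at hm
      obtain ⟨m', hm', rfl⟩ := hm
      rw [mem_Icc] at hm' ⊢
      constructor <;> omega
    refine hsub.trans (h1.trans ?_)
    have hNK : (0 : ℝ) ≤ (2 : ℝ) ^ (j + 1) + K := by positivity
    calc C₀ * ((2 : ℝ) ^ (j + 1) + K) * ∑ d ∈ normLEStar ((2 : ℝ) ^ (j + 1)),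
          ‖a j d‖ ^ 2 * (GaussianInt.content d * Real.sqrt ((2 : ℝ) ^ (j + 1) / d.norm))
        ≤ C₀ * ((2 : ℝ) ^ (j + 1) + K) * (102 * L) := mul_le_mul_of_nonneg_left (hW j hj) (mul_nonneg hC₀ hNK)
      _ ≤ C₀ * (2 * X + K) * (102 * L) := by gcongr
  -- assemble: Cauchy–Schwarz over the blocks, swap sums
  calc ∑ m ∈ Icc 1 K, ‖LSeries (moebCoeff m X) (1 / 2 + τ * I)‖ ^ 2
      = ∑ m ∈ Icc 1 K, ‖∑ j ∈ range J₀, heckeSum ((2 : ℝ) ^ (j + 1))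
          (fun d ↦ a j d * ((d.norm.natAbs : ℕ) : ℂ) ^ (-((τ : ℂ) * I))) m‖ ^ 2 := by
        refine sum_congr rfl fun m _ ↦ ?_; rw [hdecomp m]
    _ ≤ ∑ m ∈ Icc 1 K, (range J₀).card * ∑ j ∈ range J₀, ‖heckeSum ((2 : ℝ) ^ (j + 1))
          (fun d ↦ a j d * ((d.norm.natAbs : ℕ) : ℂ) ^ (-((τ : ℂ) * I))) m‖ ^ 2 :=
        sum_le_sum fun m _ ↦ norm_sum_sq_le_card_mul _ _
    _ = (J₀ : ℝ) * ∑ j ∈ range J₀, ∑ m ∈ Icc 1 K, ‖heckeSum ((2 : ℝ) ^ (j + 1))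
          (fun d ↦ a j d * ((d.norm.natAbs : ℕ) : ℂ) ^ (-((τ : ℂ) * I))) m‖ ^ 2 := by
        rw [← mul_sum, sum_comm, card_range]
    _ ≤ (J₀ : ℝ) * ∑ j ∈ range J₀, C₀ * (2 * X + K) * (102 * L) :=
        mul_le_mul_of_nonneg_left (sum_le_sum hblockMV) (Nat.cast_nonneg _)
    _ = (J₀ : ℝ) ^ 2 * (C₀ * (2 * X + K) * (102 * L)) := by rw [sum_const, card_range, nsmul_eq_mul]; ring
    _ ≤ (3 * L) ^ 2 * (C₀ * (2 * (X + K)) * (102 * L)) := by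
        have hXK : 2 * X + K ≤ 2 * (X + K) := by linarith
        gcongr
    _ = 1836 * C₀ * (X + K) * L ^ 3 := by ring
    _ ≤ 2000 * C₀ * (X + K) * (1 + Real.log X) ^ 3 := by
        rw [← hL]
        have : 0 ≤ C₀ * (X + K) * L ^ 3 := by positivity
        nlinarith

end GaussianHecke

end Literature.NumberTheory.LFunctions
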